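import Summits.BirchSwinnertonDyer.Rank1Residual.Additive.X3BranchAlgebraicCountWMult
import Summits.BirchSwinnertonDyer.Rank1Residual.Additive.X3BranchMultCongruenceDescentEndState
import HarnessLib

/-!
# X3 on the semistable-twist locus, cell (M): the `W`-level branch MAIN CONJECTURE (M) of the additive
# curve from PRINT ∧ the displayed (M) branch congruence `hGVM` ONLY — the count `hAlgW` of
# `X3BranchMultCongruenceDescent.lean` DISCHARGED by `X3BranchAlgebraicCountWMult.lean`
# (cell `bsd-addord`, seat `bsd-addord-twist`, strategy = twist transport; planner ask T-M311)

HONEST FRAMING (cell `bsd-addord`, `run/shared/lean/pub/bsd-addord/README.md` §4): the programme's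
target of record is the full Birch–Swinnerton-Dyer formula for every `E/ℚ` of analytic rank `≤ 1`;
this file concerns the X3 rows (`E[p]` reducible) of cell (M) of N10 (additive, potentially
multiplicative, `e = 2`, odd `p`). THEOREMS ONLY (no `def`, no named fact, no `sorry`); nothing booked.
PUBLISHED inputs displayed: `hW16` (Wuthrich Thm. 16), `h23`, `h414`, `hT40`/`hT41` (Tate
uniformisation); OPEN, displayed: `hGVM` (Greenberg–Vatsal's branch congruence at a MULTIPLICATIVE
prime — NOT in print: GV §3's standing set-up wants the level prime to the conductor of `χ`; referee
GAP(§4.2 P1/(M)) RESPECTED-BY-BINDER); the residual lifting `hlift` (GV p. 28/30, = the tree's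
reading-facts `residualEpsilon_surjOn_of_line[Ramified]Even`) displayed in the Literature vocabulary.

## What

* §1 `X3Branch.charIdeal_eq_span_of_multBranchCongruence_of_algebraicCountWT` — the sibling's G2
  with the torsion-displayed count (Wuthrich's torsion conclusion fed to the count).
* §2 **`X3Branch.charIdeal_eq_span_of_multBranchCongruence_of_facts_of_lifting`** — the `W`-level
  branch MC (M) ⟸ `hW16 ∧ hGVM ∧ h23 ∧ h414 ∧ hT40 ∧ hT41` + the line datum + `hlift`: on X3♯(M) the
  residue is `hGVM` ALONE. End states: `X3BranchMultEndStateOfFacts.lean`.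

References: [GreenbergVatsal2000] §2 (11), (16), pp. 14–15, 26–30, §3 pp. 38–39; [Wuthrich2014] Thm. 16;
[GreenbergLNM1716] Prop. 4.14, §5 p. 143; [Delbourgo1998] Main Conjecture p. 151; [SilvermanATAEC1994]
Ch. V Thm. 5.3, Cor. 5.4.
-/

set_option autoImplicit false

noncomputable section

open scoped Classical MatrixGroups ModularForm

namespace Summit.BirchSwinnertonDyer.Rank1Residual.Additive

open CongruenceSubgroup WeierstrassCurve NumberField IsDedekindDomain Field
  Literature.NumberTheory.EllipticCurves
  Literature.NumberTheory.EllipticCurves.ModularForms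
  Literature.NumberTheory.EllipticCurves.GreenbergVatsal2000
  Literature.NumberTheory.EllipticCurves.Rank1Residual
  Literature.NumberTheory.EllipticCurves.Rank1Residual.Typed
  Literature.NumberTheory.GaloisRepresentations
  Summit.BirchSwinnertonDyer.Rank1Residual.X1.MuLambda
  Summit.BirchSwinnertonDyer.Rank1Residual.AdditivePotMult
  Summit.BirchSwinnertonDyer.Rank1Residual.Additive.X3Branch

/-! ### §1 Twist descent on (M) with the torsion-displayed count -/

section Descent

variable {V : WeierstrassCurve ℚ} [V.IsElliptic] [V.IsGloballyMinimal]
  {W : WeierstrassCurve ℚ} [W.IsElliptic] [W.IsGloballyMinimal] {p : ℕ} [hp : Fact p.Prime]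

/-- **Cell (M), `W`-level: Delbourgo's Main Conjecture (M) of the additive `E = W` in Greenberg form,
from PRINT ∧ `hGVM` ∧ the TORSION-DISPLAYED count `hAlgWT`** (the sibling's theorem
VERBATIM except that Wuthrich's torsion conclusion at the eigen datum is fed to the count). `V` MULTIPLICATIVE at the odd `p`, `C • V^{(p*)} = W`, `Σ₀`/`Φ₀` data
on `W` (even line, non-trivial action, `χ_K`-twist ramified), `κ` cyclotomic with generator `γ`
matching the cyclotomic variable, `f` the newform of `V`, `B` a branch series of the telescope's
reduction disjunction, `D` ANY `Λ`-dual datum of `Sel_{p^∞}(W/ℚ_∞)`, `ϖ` the period ratio: then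
`X(W/ℚ_∞)` is torsion and `char_Λ X(W/ℚ_∞) = (g')` with `ι g' = u·ϖ·B`. Proof: eigen-descent
(`SelmerDualData.exists_chiEigenInCyclotomic`) then the sibling's pointwise composition at `D'.toEigen` fed by `hAlgWT` at `D`.
[cite: GreenbergLNM1716, §5 (PDF p. 143)] [cite: Wuthrich2014, Thm. 16 (p. 397)]
[cite: Delbourgo1998, Main Conjecture (p. 151)] [cite: GreenbergVatsal2000, §2 (16), §3 pp. 38–39 (shape only)] -/
theorem X3Branch.charIdeal_eq_span_of_multBranchCongruence_of_algebraicCountWT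
    (hW16 : Wuthrich2014.thm16_halfEigenCharIdeal_dvd_cyclotomicPrime)
    (hGVM : ∀ (V : WeierstrassCurve ℚ) [V.IsGloballyMinimal] [V.IsElliptic]
      (W : WeierstrassCurve ℚ) [W.IsGloballyMinimal] [W.IsElliptic] (p : ℕ) [Fact p.Prime]
      (K : Type) [Field K] [NumberField K] [(galRange (K := ℚ) K).Normal]
      (κ : ZpExtension ℚ p) {N : ℕ} [NeZero N] (f : CuspForm (Gamma0 N) 2) (B : PowerSeries ℚ_[p])
      (S₀ : Finset (HeightOneSpectrum (𝓞 ℚ)))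
      (Φ₀ : AddSubgroup (W.geomTorsion (p : ℤ))) (hΦ : IsRationalLine W p Φ₀),
      p ≠ 2 → V.HasMultiplicativeReductionAtPrime p → ¬ V.HasIrreducibleModPGaloisRep p →
      Module.finrank ℚ K = 2 → (∃ θ : K, θ ^ 2 = algebraMap ℚ K ((-1) ^ (p / 2) * p)) →
      (∃ C : VariableChange ℚ, C • V.quadraticTwist ((-1) ^ (p / 2) * p : ℚ) = W) →
      κ.IsCyclotomic →
      ((IsOrdinaryAt V p ∧
          B = if Even (p / 2) then padicLFunctionBranch f ((unitRoot V p : ℤ_[p]) : ℚ_[p]) (p / 2)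
            else padicLFunctionMinusBranch f ((unitRoot V p : ℤ_[p]) : ℚ_[p]) (p / 2)) ∨
        (V.HasSplitMultiplicativeReductionAtPrime p ∧
          B = if Even (p / 2) then padicLFunctionPlusBranchMult f (1 : ℚ_[p]) (p / 2)
            else padicLFunctionMinusBranchMult f (1 : ℚ_[p]) (p / 2)) ∨
        (V.HasMultiplicativeReductionAtPrime p ∧ ¬ V.HasSplitMultiplicativeReductionAtPrime p ∧
          B = if Even (p / 2) then padicLFunctionPlusBranchMult f (-1 : ℚ_[p]) (p / 2)
            else padicLFunctionMinusBranchMult f (-1 : ℚ_[p]) (p / 2))) →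
      IsNewformOf V f → LineEven W p Φ₀ →
      (∃ (σ : absoluteGaloisGroup ℚ) (P : W.geomTorsion (p : ℤ)), P ∈ Φ₀ ∧ σ • P ≠ P) →
      (¬ ∀ v : HeightOneSpectrum (𝓞 ℚ), ((p : ℕ) : 𝓞 ℚ) ∈ v.asIdeal →
          ∀ 𝔓 ∈ v.primesAbove, ∀ σ ∈ 𝔓.inertia (absoluteGaloisGroup ℚ), ∀ P ∈ Φ₀,
            σ • P = (if σ ∈ galRange (K := ℚ) K then P else -P)) →
      (∀ v ∈ S₀, ((p : ℕ) : 𝓞 ℚ) ∉ v.asIdeal) →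
      (∀ v : HeightOneSpectrum (𝓞 ℚ), v ∉ S₀ → ((p : ℕ) : 𝓞 ℚ) ∉ v.asIdeal →
        W.HasGoodReductionAt v) →
      ∀ (ϖ : ℚ), (if Even (p / 2) then (ϖ : ℝ) * V.realPeriodRat = plusPeriod f
          else (ϖ : ℝ) * V.imaginaryPeriodRat = minusPeriod f) →
      ∀ (b : IwasawaAlgebra p) (u : ℤ_[p]ˣ),
        iwasawaToPowerSeries p b = PowerSeries.C ((((u : ℤ_[p]) : ℚ_[p])) * ((ϖ : ℚ) : ℚ_[p])) * B →
        HasUnitContent (b * eulerFactorProduct W p S₀) ∧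
          p ^ (PowerSeries.map (PadicInt.toZMod (p := p)) (b * eulerFactorProduct W p S₀)).order.toNat =
            Nat.card (residualLineH1 W p κ S₀ Φ₀ hΦ) * Nat.card (residualQuotSelmer W p κ S₀ Φ₀ hΦ))
    (hp2 : p ≠ 2) (hmult : Mult V p) {C : VariableChange ℚ}
    (hC : C • V.quadraticTwist ((-1) ^ (p / 2) * p : ℚ) = W)
    (S₀ : Finset (HeightOneSpectrum (𝓞 ℚ))) (hS₀ : ∀ v ∈ S₀, ((p : ℕ) : 𝓞 ℚ) ∉ v.asIdeal)
    (hS : ∀ v : HeightOneSpectrum (𝓞 ℚ), v ∉ S₀ → ((p : ℕ) : 𝓞 ℚ) ∉ v.asIdeal →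
      W.HasGoodReductionAt v)
    (Φ₀ : AddSubgroup (W.geomTorsion (p : ℤ))) (hΦ : IsRationalLine W p Φ₀)
    (heven : LineEven W p Φ₀)
    (hnt : ∃ (σ : absoluteGaloisGroup ℚ) (P : W.geomTorsion (p : ℤ)), P ∈ Φ₀ ∧ σ • P ≠ P)
    (hram : ∀ (K : Type) [Field K] [NumberField K] [(galRange (K := ℚ) K).Normal],
      Module.finrank ℚ K = 2 → (∃ θ : K, θ ^ 2 = algebraMap ℚ K ((-1) ^ (p / 2) * p)) →
      ¬ ∀ v : HeightOneSpectrum (𝓞 ℚ), ((p : ℕ) : 𝓞 ℚ) ∈ v.asIdeal →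
        ∀ 𝔓 ∈ v.primesAbove, ∀ σ ∈ 𝔓.inertia (absoluteGaloisGroup ℚ), ∀ P ∈ Φ₀,
          σ • P = (if σ ∈ galRange (K := ℚ) K then P else -P))
    (hAlgWT : ∀ {κ : ZpExtension ℚ p} {γ : Field.absoluteGaloisGroup ℚ} (D : W.SelmerDualData κ γ)
      (g : IwasawaAlgebra p), κ.IsCyclotomic → κ.IsTopGenerator γ → D.IsTorsion →
      D.charIdeal = Ideal.span {g} → HasUnitContent g →
        p ^ (lam g + ∑ v ∈ S₀, delta W p v) =
          Nat.card (residualLineH1 W p κ S₀ Φ₀ hΦ) * Nat.card (residualQuotSelmer W p κ S₀ Φ₀ hΦ))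
    {κ : ZpExtension ℚ p} {γ : Field.absoluteGaloisGroup ℚ} {N : ℕ} [NeZero N]
    {f : CuspForm (Gamma0 N) 2} {B : PowerSeries ℚ_[p]}
    (hκ : κ.IsCyclotomic) (hγ : κ.IsTopGenerator γ) (hcv : IsCyclotomicVariable p γ)
    (hf : IsNewformOf V f)
    (hred : ((IsOrdinaryAt V p ∧
        B = if Even (p / 2) then padicLFunctionBranch f ((unitRoot V p : ℤ_[p]) : ℚ_[p]) (p / 2)
          else padicLFunctionMinusBranch f ((unitRoot V p : ℤ_[p]) : ℚ_[p]) (p / 2)) ∨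
      (V.HasSplitMultiplicativeReductionAtPrime p ∧
        B = if Even (p / 2) then padicLFunctionPlusBranchMult f (1 : ℚ_[p]) (p / 2)
          else padicLFunctionMinusBranchMult f (1 : ℚ_[p]) (p / 2)) ∨
      (V.HasMultiplicativeReductionAtPrime p ∧ ¬ V.HasSplitMultiplicativeReductionAtPrime p ∧
        B = if Even (p / 2) then padicLFunctionPlusBranchMult f (-1 : ℚ_[p]) (p / 2)
          else padicLFunctionMinusBranchMult f (-1 : ℚ_[p]) (p / 2))))
    (D : W.SelmerDualData κ γ) (ϖ : ℚ)
    (hϖ : if Even (p / 2) then (ϖ : ℝ) * V.realPeriodRat = plusPeriod f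
        else (ϖ : ℝ) * V.imaginaryPeriodRat = minusPeriod f) :
    D.IsTorsion ∧ ∃ g' : IwasawaAlgebra p, D.charIdeal = Ideal.span {g'} ∧ ∃ u : ℤ_[p]ˣ,
      iwasawaToPowerSeries p g' = PowerSeries.C (((u : ℤ_[p]) : ℚ_[p]) * (ϖ : ℚ_[p])) * B := by
  have hpS : ((-1 : ℚ) ^ (p / 2) * p) ≠ 0 := pStar_ne_zero p
  have hirr : ¬ V.HasIrreducibleModPGaloisRep p := fun hV ↦
    not_hasIrreducibleModPGaloisRep_of_isRationalLine hΦ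
      ((irr_iff_of_model_twist (W := V) (p := p) hpS ⟨C, hC⟩).mpr hV)
  haveI hcycL : IsCyclotomicExtension {p} ℚ (CyclotomicField p ℚ) := by
    have h : (CyclotomicField.algebra p ℚ : Algebra ℚ (CyclotomicField p ℚ)) =
        DivisionRing.toRatAlgebra := Subsingleton.elim _ _
    exact h ▸ CyclotomicField.isCyclotomicExtension p ℚ
  obtain ⟨K, θ, hK2, hθ, hθ2⟩ := exists_intermediateField_sq_eq_pStar p (CyclotomicField p ℚ) hp2
  haveI : NumberField K := NumberField.of_module_finite ℚ K
  haveI : IsGalois ℚ K := isGalois_of_finrank_eq_two K hK2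
  haveI := normal_galRange K hK2 (sigmaQ_ne_one K hK2 hθ hθ2)
  haveI := normal_galRange_cyclotomic p (CyclotomicField p ℚ)
  haveI : (V.quadraticTwist ((-1 : ℚ) ^ (p / 2) * p)).IsElliptic := V.isElliptic_quadraticTwist hpS
  obtain ⟨γ', hγ'KF, hκγ', ⟨g₀, hg₀, hγ'eq⟩, D', hchar, htor⟩ :=
    SelmerDualData.exists_chiEigenInCyclotomic p (CyclotomicField p ℚ) V K hK2 hθ hθ2 κ hC hp2 D
  -- Wuthrich's Thm. 16 at the eigen datum: the module `D'.X = D.X` is `Λ`-torsion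
  have hγ' : κ.IsTopGenerator γ' := isTopGenerator_of_kappa_eq κ hκγ' hγ
  have hcv' : IsCyclotomicVariable p γ' := isCyclotomicVariable_of_eq_mul p κ hκ hg₀ hγ'eq hcv
  obtain ⟨htorsE, -⟩ := hW16 p V K (CyclotomicField p ℚ) _ hp2 hK2 ⟨θ, hθ2⟩ hred
    hirr hκ hγ' hcv' (Subgroup.mem_inf.mp hγ'KF).1 (Subgroup.mem_inf.mp hγ'KF).2 hf
    (ChiEigenSelmerInDualData.toEigen V K κ (galRange (K := ℚ) (CyclotomicField p ℚ)) γ' D') ϖ hϖ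
  have htorsD : D.IsTorsion := htor.mp htorsE
  have key := X3Branch.charIdeal_eq_span_of_multBranchCongruence_of_count (V := V) (W := W) hW16 hGVM
    hmult ⟨C, hC⟩ S₀ hS₀ hS Φ₀ hΦ heven hnt K (CyclotomicField p ℚ) (κ := κ) (γ := γ') (f := f)
    (B := B) hp2 hK2 ⟨θ, hθ2⟩ hred (hram K hK2 ⟨θ, hθ2⟩) hirr hκ hγ' hcv'
    (Subgroup.mem_inf.mp hγ'KF).1 (Subgroup.mem_inf.mp hγ'KF).2 hf
    (ChiEigenSelmerInDualData.toEigen V K κ (galRange (K := ℚ) (CyclotomicField p ℚ)) γ' D') ϖ hϖ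
    (fun g hg hμ ↦ hAlgWT D g hκ hγ htorsD (hchar ▸ hg) hμ)
  obtain ⟨-, g', hchar', u, hι⟩ := key
  exact ⟨htorsD, g', hchar ▸ hchar', u, hι⟩


/-! ### §2 … from PRINT ∧ `hGVM` only -/

/-- **Cell (M), `W`-level: Delbourgo's Main Conjecture (M) of the additive `E = W` in Greenberg form
from PRINT ∧ `hGVM` ONLY** — the count `hAlgW` of the sibling DISCHARGED
(`X3Branch.algebraicCountWMult_of_facts_of_lifting`: records `h23`, `h414`, `hT40`, `hT41`; the
residual lifting `hlift` displayed in the Literature vocabulary, = the reading-facts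
`residualEpsilon_surjOn_of_line[Ramified]Even`; `W` potentially multiplicative, `hpm`). So on X3♯(M)
the ONE remaining non-published input is the analytic binder `hGVM`.
[cite: GreenbergLNM1716, §5 (PDF p. 143), Prop. 4.14] [cite: Wuthrich2014, Thm. 16 (p. 397)]
[cite: Delbourgo1998, Main Conjecture (p. 151)] [cite: GreenbergVatsal2000, §2 (11), (16), pp. 14–15, 26–30]
[cite: SilvermanATAEC1994, Ch. V Thm. 5.3, Cor. 5.4] -/
theorem X3Branch.charIdeal_eq_span_of_multBranchCongruence_of_facts_of_lifting
    (hW16 : Wuthrich2014.thm16_halfEigenCharIdeal_dvd_cyclotomicPrime)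
    (hGVM : ∀ (V : WeierstrassCurve ℚ) [V.IsGloballyMinimal] [V.IsElliptic]
      (W : WeierstrassCurve ℚ) [W.IsGloballyMinimal] [W.IsElliptic] (p : ℕ) [Fact p.Prime]
      (K : Type) [Field K] [NumberField K] [(galRange (K := ℚ) K).Normal]
      (κ : ZpExtension ℚ p) {N : ℕ} [NeZero N] (f : CuspForm (Gamma0 N) 2) (B : PowerSeries ℚ_[p])
      (S₀ : Finset (HeightOneSpectrum (𝓞 ℚ)))
      (Φ₀ : AddSubgroup (W.geomTorsion (p : ℤ))) (hΦ : IsRationalLine W p Φ₀),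
      p ≠ 2 → V.HasMultiplicativeReductionAtPrime p → ¬ V.HasIrreducibleModPGaloisRep p →
      Module.finrank ℚ K = 2 → (∃ θ : K, θ ^ 2 = algebraMap ℚ K ((-1) ^ (p / 2) * p)) →
      (∃ C : VariableChange ℚ, C • V.quadraticTwist ((-1) ^ (p / 2) * p : ℚ) = W) →
      κ.IsCyclotomic →
      ((IsOrdinaryAt V p ∧
          B = if Even (p / 2) then padicLFunctionBranch f ((unitRoot V p : ℤ_[p]) : ℚ_[p]) (p / 2)
            else padicLFunctionMinusBranch f ((unitRoot V p : ℤ_[p]) : ℚ_[p]) (p / 2)) ∨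
        (V.HasSplitMultiplicativeReductionAtPrime p ∧
          B = if Even (p / 2) then padicLFunctionPlusBranchMult f (1 : ℚ_[p]) (p / 2)
            else padicLFunctionMinusBranchMult f (1 : ℚ_[p]) (p / 2)) ∨
        (V.HasMultiplicativeReductionAtPrime p ∧ ¬ V.HasSplitMultiplicativeReductionAtPrime p ∧
          B = if Even (p / 2) then padicLFunctionPlusBranchMult f (-1 : ℚ_[p]) (p / 2)
            else padicLFunctionMinusBranchMult f (-1 : ℚ_[p]) (p / 2))) →
      IsNewformOf V f → LineEven W p Φ₀ →
      (∃ (σ : absoluteGaloisGroup ℚ) (P : W.geomTorsion (p : ℤ)), P ∈ Φ₀ ∧ σ • P ≠ P) →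
      (¬ ∀ v : HeightOneSpectrum (𝓞 ℚ), ((p : ℕ) : 𝓞 ℚ) ∈ v.asIdeal →
          ∀ 𝔓 ∈ v.primesAbove, ∀ σ ∈ 𝔓.inertia (absoluteGaloisGroup ℚ), ∀ P ∈ Φ₀,
            σ • P = (if σ ∈ galRange (K := ℚ) K then P else -P)) →
      (∀ v ∈ S₀, ((p : ℕ) : 𝓞 ℚ) ∉ v.asIdeal) →
      (∀ v : HeightOneSpectrum (𝓞 ℚ), v ∉ S₀ → ((p : ℕ) : 𝓞 ℚ) ∉ v.asIdeal →
        W.HasGoodReductionAt v) →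
      ∀ (ϖ : ℚ), (if Even (p / 2) then (ϖ : ℝ) * V.realPeriodRat = plusPeriod f
          else (ϖ : ℝ) * V.imaginaryPeriodRat = minusPeriod f) →
      ∀ (b : IwasawaAlgebra p) (u : ℤ_[p]ˣ),
        iwasawaToPowerSeries p b = PowerSeries.C ((((u : ℤ_[p]) : ℚ_[p])) * ((ϖ : ℚ) : ℚ_[p])) * B →
        HasUnitContent (b * eulerFactorProduct W p S₀) ∧
          p ^ (PowerSeries.map (PadicInt.toZMod (p := p)) (b * eulerFactorProduct W p S₀)).order.toNat =
            Nat.card (residualLineH1 W p κ S₀ Φ₀ hΦ) * Nat.card (residualQuotSelmer W p κ S₀ Φ₀ hΦ))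
    (hp2 : p ≠ 2) (hpm : AdditivePotMult.PotMult W p) (hmult : Mult V p) {C : VariableChange ℚ}
    (hC : C • V.quadraticTwist ((-1) ^ (p / 2) * p : ℚ) = W)
    (S₀ : Finset (HeightOneSpectrum (𝓞 ℚ))) (hS₀ : ∀ v ∈ S₀, ((p : ℕ) : 𝓞 ℚ) ∉ v.asIdeal)
    (hS : ∀ v : HeightOneSpectrum (𝓞 ℚ), v ∉ S₀ → ((p : ℕ) : 𝓞 ℚ) ∉ v.asIdeal →
      W.HasGoodReductionAt v)
    (Φ₀ : AddSubgroup (W.geomTorsion (p : ℤ))) (hΦ : IsRationalLine W p Φ₀)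
    (heven : LineEven W p Φ₀)
    (hnt : ∃ (σ : absoluteGaloisGroup ℚ) (P : W.geomTorsion (p : ℤ)), P ∈ Φ₀ ∧ σ • P ≠ P)
    (hram : ∀ (K : Type) [Field K] [NumberField K] [(galRange (K := ℚ) K).Normal],
      Module.finrank ℚ K = 2 → (∃ θ : K, θ ^ 2 = algebraMap ℚ K ((-1) ^ (p / 2) * p)) →
      ¬ ∀ v : HeightOneSpectrum (𝓞 ℚ), ((p : ℕ) : 𝓞 ℚ) ∈ v.asIdeal →
        ∀ 𝔓 ∈ v.primesAbove, ∀ σ ∈ 𝔓.inertia (absoluteGaloisGroup ℚ), ∀ P ∈ Φ₀,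
          σ • P = (if σ ∈ galRange (K := ℚ) K then P else -P))
    (h23 : datumSelmer_nonPrimitive_invariants)
    (h414 : Greenberg1999.prop414_noFiniteSubmodule_of_not_dvd_torsionOrder)
    (hT40 : Silverman1994_thmV53_tateUniformisation.{0})
    (hT41 : Silverman1994_thmV53_corV54_tateUniformisation.{0})
    (hlift : ∀ (κ : ZpExtension ℚ p), κ.IsCyclotomic →
      ∀ s ∈ residualQuotSelmer W p κ S₀ Φ₀ hΦ, ∃ x ∈ residualTorsionH1 W p κ S₀,
        residualEpsilon W p κ Φ₀ hΦ x = s)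
    {κ : ZpExtension ℚ p} {γ : Field.absoluteGaloisGroup ℚ} {N : ℕ} [NeZero N]
    {f : CuspForm (Gamma0 N) 2} {B : PowerSeries ℚ_[p]}
    (hκ : κ.IsCyclotomic) (hγ : κ.IsTopGenerator γ) (hcv : IsCyclotomicVariable p γ)
    (hf : IsNewformOf V f)
    (hred : ((IsOrdinaryAt V p ∧
        B = if Even (p / 2) then padicLFunctionBranch f ((unitRoot V p : ℤ_[p]) : ℚ_[p]) (p / 2)
          else padicLFunctionMinusBranch f ((unitRoot V p : ℤ_[p]) : ℚ_[p]) (p / 2)) ∨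
      (V.HasSplitMultiplicativeReductionAtPrime p ∧
        B = if Even (p / 2) then padicLFunctionPlusBranchMult f (1 : ℚ_[p]) (p / 2)
          else padicLFunctionMinusBranchMult f (1 : ℚ_[p]) (p / 2)) ∨
      (V.HasMultiplicativeReductionAtPrime p ∧ ¬ V.HasSplitMultiplicativeReductionAtPrime p ∧
        B = if Even (p / 2) then padicLFunctionPlusBranchMult f (-1 : ℚ_[p]) (p / 2)
          else padicLFunctionMinusBranchMult f (-1 : ℚ_[p]) (p / 2))))
    (D : W.SelmerDualData κ γ) (ϖ : ℚ)
    (hϖ : if Even (p / 2) then (ϖ : ℝ) * V.realPeriodRat = plusPeriod f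
        else (ϖ : ℝ) * V.imaginaryPeriodRat = minusPeriod f) :
    D.IsTorsion ∧ ∃ g' : IwasawaAlgebra p, D.charIdeal = Ideal.span {g'} ∧ ∃ u : ℤ_[p]ˣ,
      iwasawaToPowerSeries p g' = PowerSeries.C (((u : ℤ_[p]) : ℚ_[p]) * (ϖ : ℚ_[p])) * B :=
  X3Branch.charIdeal_eq_span_of_multBranchCongruence_of_algebraicCountWT hW16 hGVM hp2 hmult hC S₀ hS₀
    hS Φ₀ hΦ heven hnt hram
    (fun D g hκ' hγ' hDt hg hμ ↦ X3Branch.algebraicCountWMult_of_facts_of_lifting h23 h414 hT40 hT41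
      hp2 hpm V hmult hC S₀ hS₀ hS Φ₀ hΦ heven hnt hram hlift D g hκ' hγ' hDt hg hμ)
    hκ hγ hcv hf hred D ϖ hϖ

end Descent

end Summit.BirchSwinnertonDyer.Rank1Residual.Additive

end
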